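import Literature.NumberTheory.Automorphic.HarishChandraGLAntipode
import Literature.NumberTheory.Automorphic.HarishChandraGLConj
import Literature.NumberTheory.Automorphic.HarishChandraGLParameterOfCharacter
import HarnessLib

/-!
# A unitary `𝔤𝔩ₙ`-module has a Hermitian-symmetric Harish-Chandra parameter:
# `χ(c ∘ τ) = {-ā : a ∈ χ(τ)}` (the archimedean purity relation on multisets)

Topic `NumberTheory/Automorphic`; theorems only, next to `HarishChandraGL`,
`HarishChandraGLAntipode` (`γ(S z)(x) = γ(z)(-x)`), `HarishChandraGLConj` (the conjugate
Harish-Chandra homomorphism `γ̄`; `γ̄ = γ`) and `ArchParameterUnique` (uniqueness of parameters).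
Let `(V, ρ)` be a module for the real Lie algebra `𝔤𝔩ₙ(𝕜)` (`𝕜 = ℝ, ℂ`) carrying a sesquilinear
form `B` for which `𝔤` acts by skew-Hermitian operators, `B(X v, w) = -B(v, X w)` — the
infinitesimal form of an invariant Hermitian form of a unitary representation (Knapp–Vogan 1995,
Ch. IX §1, (0.5)) — with `B(v, v) ≠ 0` for some `v`.

* `pairing_lift_eq_pairing_lift_antiR` — **the antipode is the adjoint**: `B(u v, w) = B(v, S(u) w)`
  for `u ∈ U(𝔤)` (induction on `u`).
* `HasCentralCharacter.eq_conj_antiR` — if `Z(𝔤)` acts by `θ`, then `θ(z) = \overline{θ(S z)}`.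
* `HarishChandraHomGL.aeval_eq_conj_aeval_conj` — `γ` is real: `γ(z)(g) = \overline{γ(z)(g^c)}`,
  `g^c(τ, i) = \overline{g(c ∘ τ, i)}` (from `γ̄ = γ`, `harishChandraHomGL_unique_holds`).
* **`HasHCParameter.map_neg_conj_of_skewHermitian`** — if `(V, ρ)` has Harish-Chandra parameter
  `χ`, then `χ(c ∘ τ) = {-ā : a ∈ χ(τ)}` for every `τ : 𝕜 →ₐ[ℝ] ℂ`: with the three items above,
  `θ(z) = γ(z)(x) = \overline{γ(z)(-x)} = γ(z)(-x^c)`, so `τ ↦ {-ā : a ∈ χ(c∘τ)}` is ALSO a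
  parameter of `V`, and parameters are unique (`HasHCParameter.unique`).
* **`HasArchParameter.map_neg_conj_of_skewHermitian`** — for `𝔤𝔩ₙ(K_∞)` (`K` a number field) and
  an archimedean parameter `χ` indexed by the complex embeddings: `χ(σ̄) = {-ā : a ∈ χ(σ)}` for
  every `σ : K → ℂ` (real places: `σ̄ = σ`; complex places: the two copies `id`, `conj`).

For the archimedean component of a unitary cuspidal automorphic representation this is the
weight-`0` case of Clozel's purity lemma on multisets (Clozel 1990, Lemme 4.9: "`π` cuspidale ⟹
`π ⊗ |det|^{w/2}` unitaire … `p_i + q_{w(i)} = w`"); the automorphic assembly is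
`ClozelPurityProofs`.

## References

* A. W. Knapp, D. A. Vogan, *Cohomological Induction and Unitary Representations* (1995), Ch. IX
  §1, p. 597 (invariant Hermitian forms). [KnappVogan1995]
* A. W. Knapp, *Lie Groups Beyond an Introduction*, 2nd ed. (2002), §V.5, Thm. 5.44. [Knapp2002]
* L. Clozel, *Motifs et formes automorphes* (1990), Lemme 4.9. [Clozel1990]
-/

-- Mathlib idiom (Mathlib/Algebra/Lie/OfAssociative.lean): the commutator bracket on associative rings
attribute [local instance 100] LieRing.ofAssociativeRing

open scoped Matrix ComplexConjugate

noncomputable section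

namespace Literature.NumberTheory.Automorphic

open MvPolynomial

/-! ### One place factor `𝔤𝔩ₙ(𝕜)` -/

section OnePlace

variable {𝕜 : Type*} [RCLike 𝕜] {n : ℕ} {V : Type*} [AddCommGroup V] [Module ℂ V]

local notation "Uℝ" => UniversalEnvelopingAlgebra ℝ (Matrix (Fin n) (Fin n) 𝕜)

/-- **The antipode is the adjoint for a `𝔤`-skew-Hermitian form.** Let `B` be a sesquilinear form
on a `𝔤𝔩ₙ(𝕜)`-module `(V, ρ)` for which `𝔤` acts by skew-Hermitian operators,
`B(X v, w) = -B(v, X w)` (e.g. an invariant Hermitian form of a unitary representation,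
Knapp–Vogan 1995, Ch. IX §1, (0.5)). Then `B(u v, w) = B(v, S(u) w)` for every `u ∈ U(𝔤)`, `S` the
antipode (by induction on `u`). [cite: KnappVogan1995, Ch. IX §1 (p. 597)] -/
theorem pairing_lift_eq_pairing_lift_antiR (ρ : Matrix (Fin n) (Fin n) 𝕜 →ₗ⁅ℝ⁆ Module.End ℂ V)
    (B : V → V → ℂ) (hadd₁ : ∀ u v w, B (u + v) w = B u w + B v w)
    (hadd₂ : ∀ u v w, B u (v + w) = B u v + B u w)
    (hsmul₁ : ∀ (c : ℂ) v w, B (c • v) w = c * B v w)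
    (hsmul₂ : ∀ (c : ℂ) v w, B v (c • w) = conj c * B v w)
    (hskew : ∀ (X : Matrix (Fin n) (Fin n) 𝕜) v w, B (ρ X v) w = -B v (ρ X w))
    (u : Uℝ) (v w : V) :
    B (UniversalEnvelopingAlgebra.lift ℝ ρ u v) w = B v (UniversalEnvelopingAlgebra.lift ℝ ρ (antiR u) w) := by
  induction u using UniversalEnvelopingAlgebra.induction_on' generalizing v w with
  | algebraMap r =>
    rw [antiR_algebraMap, AlgHom.commutes, Module.algebraMap_end_apply, Module.algebraMap_end_apply,
      RCLike.real_smul_eq_coe_smul (K := ℂ), RCLike.real_smul_eq_coe_smul (K := ℂ), hsmul₁, hsmul₂,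
      RCLike.conj_ofReal]
  | ι X =>
    rw [antiR_ι, map_neg, UniversalEnvelopingAlgebra.lift_ι_apply, LinearMap.neg_apply, hskew,
      ← neg_one_smul ℂ (ρ X w), hsmul₂, map_neg, map_one, neg_one_mul]
  | mul a b ha hb =>
    rw [antiR_mul, map_mul, map_mul, Module.End.mul_apply, Module.End.mul_apply, ha, hb]
  | add a b ha hb =>
    rw [antiR_add, map_add, map_add, LinearMap.add_apply, LinearMap.add_apply, hadd₁, hadd₂, ha, hb]

/-- **Unitarity forces `θ(z) = \overline{θ(S z)}`**: if `Z(𝔤)` acts on `V` by `θ` and `V` carries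
a `𝔤`-skew-Hermitian sesquilinear form `B` with `B(v, v) ≠ 0` for some `v`, then
`θ(z) = \overline{θ(S z)}` for every central `z` (`θ(z) B(v,v) = B(z v, v) = B(v, S z v) =
\overline{θ(S z)} B(v, v)`). Knapp–Vogan 1995, Ch. IX §1. [cite: KnappVogan1995, Ch. IX §1 (p. 597)] -/
theorem HasCentralCharacter.eq_conj_antiR {ρ : Matrix (Fin n) (Fin n) 𝕜 →ₗ⁅ℝ⁆ Module.End ℂ V}
    {θ : Subalgebra.center ℝ Uℝ →ₐ[ℝ] ℂ} (hθ : HasCentralCharacter ρ θ)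
    (B : V → V → ℂ) (hadd₁ : ∀ u v w, B (u + v) w = B u w + B v w)
    (hadd₂ : ∀ u v w, B u (v + w) = B u v + B u w)
    (hsmul₁ : ∀ (c : ℂ) v w, B (c • v) w = c * B v w)
    (hsmul₂ : ∀ (c : ℂ) v w, B v (c • w) = conj c * B v w)
    (hskew : ∀ (X : Matrix (Fin n) (Fin n) 𝕜) v w, B (ρ X v) w = -B v (ρ X w))
    {v : V} (hv : B v v ≠ 0) (z : Subalgebra.center ℝ Uℝ) :
    θ z = conj (θ ⟨antiR (z : Uℝ), antiR_mem_center z.2⟩) := by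
  have h := pairing_lift_eq_pairing_lift_antiR ρ B hadd₁ hadd₂ hsmul₁ hsmul₂ hskew (z : Uℝ) v v
  have h1 := LinearMap.congr_fun (hθ z) v
  have h2 := LinearMap.congr_fun (hθ ⟨antiR (z : Uℝ), antiR_mem_center z.2⟩) v
  rw [Module.algebraMap_end_apply] at h1 h2
  rw [h1, hsmul₁] at h
  change _ = B v (UniversalEnvelopingAlgebra.lift ℝ ρ (antiR (z : Uℝ)) v) at h
  rw [h2, hsmul₂] at h
  exact mul_right_cancel₀ hv h

/-- **The Harish-Chandra homomorphism is real**: `γ(z)(g) = \overline{γ(z)(g^c)}` with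
`g^c(τ, i) = \overline{g(c ∘ τ, i)}` — from `γ̄ = γ` (`HarishChandraHomGL.conj` of
`HarishChandraGLConj`, `harishChandraHomGL_unique_holds`). [cite: Knapp2002, §V.5 Thm. 5.44] -/
theorem HarishChandraHomGL.aeval_eq_conj_aeval_conj (γ : HarishChandraHomGL 𝕜 n)
    (z : Subalgebra.center ℝ Uℝ) (g : (𝕜 →ₐ[ℝ] ℂ) × Fin n → ℂ) :
    MvPolynomial.aeval g (γ.toAlgHom z) =
      conj (MvPolynomial.aeval (fun x ↦ conj (g (conjVarEquiv 𝕜 n x))) (γ.toAlgHom z)) := by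
  have h : γ.conj = γ := harishChandraHomGL_unique_holds γ.conj γ
  conv_lhs => rw [← h, HarishChandraHomGL.conj_toAlgHom_apply, aeval_conjPolyHom]

/-- **A unitary `𝔤𝔩ₙ(𝕜)`-module has a Hermitian-symmetric Harish-Chandra parameter.** Let
`(V, ρ)` have Harish-Chandra parameter `χ` and carry a `𝔤`-skew-Hermitian sesquilinear form `B`
with `B(v, v) ≠ 0` for some `v` (e.g. a positive definite invariant Hermitian form). Then
`χ(c ∘ τ) = {-ā : a ∈ χ(τ)}` for every `τ : 𝕜 →ₐ[ℝ] ℂ` (for `𝕜 = ℝ`: `χ = -χ̄`; for `𝕜 = ℂ`: the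
parameter on the `conj`-copy is minus the conjugate of that on the `id`-copy) — the infinitesimal
character is Hermitian-symmetric, `x ∼_W -x^c`, because `θ(z) = \overline{θ(S z)}`
(`HasCentralCharacter.eq_conj_antiR`), `γ(S z)(x) = γ(z)(-x)` (`HarishChandraHomGL.aeval_antiR`)
and `γ` is real (`aeval_eq_conj_aeval_conj`), so that `χ' (τ) = {-ā : a ∈ χ(c∘τ)}` is ALSO a
Harish-Chandra parameter of `V`, and parameters are unique (`HasHCParameter.unique`). On Langlands
parameters restricted to `ℂˣ` this is `{a at σ̄} = {-ā : a at σ}` for a unitary representation: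
Clozel 1990, Lemme 4.9 (purity, weight `0`) on multisets; Knapp–Vogan 1995, Ch. IX §1.
[cite: Clozel1990, Lemme 4.9] [cite: KnappVogan1995, Ch. IX §1 (p. 597)] -/
theorem HasHCParameter.map_neg_conj_of_skewHermitian {ρ : Matrix (Fin n) (Fin n) 𝕜 →ₗ⁅ℝ⁆ Module.End ℂ V}
    {χ : (𝕜 →ₐ[ℝ] ℂ) → Multiset ℂ} (hχ : HasHCParameter ρ χ)
    (B : V → V → ℂ) (hadd₁ : ∀ u v w, B (u + v) w = B u w + B v w)
    (hadd₂ : ∀ u v w, B u (v + w) = B u v + B u w)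
    (hsmul₁ : ∀ (c : ℂ) v w, B (c • v) w = c * B v w)
    (hsmul₂ : ∀ (c : ℂ) v w, B v (c • w) = conj c * B v w)
    (hskew : ∀ (X : Matrix (Fin n) (Fin n) 𝕜) v w, B (ρ X v) w = -B v (ρ X w))
    {v : V} (hv : B v v ≠ 0) (τ : 𝕜 →ₐ[ℝ] ℂ) :
    χ (conjIdx τ) = (χ τ).map fun a ↦ -conj a := by
  classical
  -- `V ≠ 0`
  have hv0 : v ≠ 0 := by
    rintro rfl
    apply hv
    rw [← zero_smul ℂ (0 : V), hsmul₁, zero_mul]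
  haveI : Nontrivial V := nontrivial_of_ne v 0 hv0
  obtain ⟨hcard, θ, hθ, hγ⟩ := id hχ
  -- the Hermitian-symmetric parameter `χ'` is also a parameter of `V`
  have hχ' : HasHCParameter ρ fun τ ↦ (χ (conjIdx τ)).map fun a ↦ -conj a := by
    refine ⟨fun τ ↦ by rw [Multiset.card_map, hcard], θ, hθ, fun γ l' hl' z ↦ ?_⟩
    choose l hl using fun τ ↦ exists_enum_of_card_eq' (χ τ) (hcard τ)
    -- `θ z = \overline{θ(S z)} = \overline{γ(z)(-l)} = γ(z)((-l)^c)`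
    rw [hθ.eq_conj_antiR B hadd₁ hadd₂ hsmul₁ hsmul₂ hskew hv z, hγ γ l hl ⟨_, antiR_mem_center z.2⟩,
      γ.aeval_antiR z.2, γ.aeval_eq_conj_aeval_conj, Complex.conj_conj]
    -- `(-l)^c` and `l'` both enumerate `χ'`
    set l₀ : (𝕜 →ₐ[ℝ] ℂ) → Fin n → ℂ := fun τ' i ↦ -conj (l (conjIdx τ') i) with hl₀
    have hfun : (fun x : (𝕜 →ₐ[ℝ] ℂ) × Fin n ↦
        conj (-l (conjVarEquiv 𝕜 n x).1 (conjVarEquiv 𝕜 n x).2)) = fun p ↦ l₀ p.1 p.2 := by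
      funext x
      rw [conjVarEquiv_apply, map_neg]
    rw [hfun]
    refine aeval_eq_aeval_of_map_univ_eq (γ.toAlgHom_mem_symmetricSubalgebraGL _) fun τ' ↦ ?_
    rw [hl' τ']
    dsimp only
    rw [← hl (conjIdx τ'), Multiset.map_map]
    rfl
  have heq := HasHCParameter.unique ρ hχ hχ'
  have h : χ τ = (χ (conjIdx τ)).map fun a ↦ -conj a := congrFun heq τ
  -- apply the involution `a ↦ -ā` to both sides
  have h2 := congrArg (Multiset.map fun a : ℂ ↦ -conj a) h
  rw [Multiset.map_map] at h2
  have hcc : ((fun a : ℂ ↦ -conj a) ∘ fun a : ℂ ↦ -conj a) = id := by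
    funext a
    simp
  rw [hcc, Multiset.map_id] at h2
  exact h2.symm

end OnePlace

/-! ### All places: `𝔤𝔩ₙ(K_∞)` -/

section AllPlaces

open _root_.NumberField _root_.NumberField.InfinitePlace _root_.NumberField.mixedEmbedding

-- `K : Type` (universe `0`), as for the automorphic data and `ArchParameterUnique`
variable {K : Type} [Field K] {n : ℕ} {V : Type*} [AddCommGroup V] [Module ℂ V]

/-- **A unitary `𝔤𝔩ₙ(K_∞)`-module has a Hermitian-symmetric archimedean parameter**:
`χ(σ̄) = {-ā : a ∈ χ(σ)}` for every complex embedding `σ` of `K`, if `(V, ρ)` has archimedean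
parameter `χ` and carries a `𝔤`-skew-Hermitian sesquilinear form `B` with some `B(v, v) ≠ 0`
(`HasHCParameter.map_neg_conj_of_skewHermitian` at each place: at a real place `σ̄ = σ`, at a
complex place the two embeddings are the two copies `id`, `conj`). For the archimedean component
of a unitary automorphic representation this is Clozel's purity lemma with weight `0` on
multisets. [cite: Clozel1990, Lemme 4.9] [cite: KnappVogan1995, Ch. IX §1 (p. 597)] -/
theorem HasArchParameter.map_neg_conj_of_skewHermitian
    {ρ : Matrix (Fin n) (Fin n) (mixedSpace K) →ₗ⁅ℝ⁆ Module.End ℂ V}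
    {χ : (K →+* ℂ) → Multiset ℂ} (hχ : HasArchParameter ρ χ)
    (B : V → V → ℂ) (hadd₁ : ∀ u v w, B (u + v) w = B u w + B v w)
    (hadd₂ : ∀ u v w, B u (v + w) = B u v + B u w)
    (hsmul₁ : ∀ (c : ℂ) v w, B (c • v) w = c * B v w)
    (hsmul₂ : ∀ (c : ℂ) v w, B v (c • w) = conj c * B v w)
    (hskew : ∀ (Y : Matrix (Fin n) (Fin n) (mixedSpace K)) v w, B (ρ Y v) w = -B v (ρ Y w))
    {v : V} (hv : B v v ≠ 0) (σ : K →+* ℂ) :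
    χ (ComplexEmbedding.conjugate σ) = (χ σ).map fun a ↦ -conj a := by
  obtain ⟨hre, hco⟩ := hχ
  by_cases hw : (mk σ).IsReal
  · -- real place: `σ̄ = σ`, one embedding `ℝ → ℂ`
    have hσ : ComplexEmbedding.IsReal σ := isReal_mk_iff.mp hw
    have h := (hre ⟨mk σ, hw⟩).map_neg_conj_of_skewHermitian B hadd₁ hadd₂ hsmul₁ hsmul₂
      (fun X ↦ hskew _) hv (Algebra.ofId ℝ ℂ)
    dsimp only at h
    rw [embedding_mk_eq_of_isReal hσ] at h
    rw [ComplexEmbedding.isReal_iff.mp hσ]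
    exact h
  · -- complex place `w`: the embeddings above `w` are `σ_w` and `σ̄_w`
    have main : ∀ (w : {w : InfinitePlace K // IsComplex w}) (φ : K →+* ℂ), mk φ = w.1 →
        χ (ComplexEmbedding.conjugate φ) = (χ φ).map fun a ↦ -conj a := by
      intro w φ hφ
      have h := (hco w).map_neg_conj_of_skewHermitian B hadd₁ hadd₂ hsmul₁ hsmul₂
        (fun X ↦ hskew _) hv (AlgHom.id ℝ ℂ)
      have hid : conjIdx (AlgHom.id ℝ ℂ) = (Complex.conjAe : ℂ →ₐ[ℝ] ℂ) := AlgHom.ext fun _ ↦ rfl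
      rw [hid, conjAe_toRingHom_comp, algHomId_toRingHom_comp] at h
      -- `h : χ (σ̄_w) = (χ σ_w).map (-conj ·)`; now `φ = σ_w` or `φ = σ̄_w`
      rcases mk_eq_iff.mp (hφ.trans (mk_embedding w.1).symm) with h1 | h1
      · rw [h1]
        exact h
      · have h2 : φ = ComplexEmbedding.conjugate w.1.embedding := by
          rw [← h1]
          exact (star_star φ).symm
        rw [h2, h, Multiset.map_map]
        have hcc : ((fun a : ℂ ↦ -conj a) ∘ fun a : ℂ ↦ -conj a) = id := by
          funext a
          simp
        rw [hcc, Multiset.map_id]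
        exact congrArg χ (star_star _)
    exact main ⟨mk σ, not_isReal_iff_isComplex.mp hw⟩ σ rfl

end AllPlaces

end Literature.NumberTheory.Automorphic

end
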